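import Literature.Analysis.SegalBargmann.HermiteSumCalculus
import Literature.Analysis.SegalBargmann.FockInfinitesimalAction
import HarnessLib

/-!
# `x_j`, `D_j` and the Fourier transform on finite Hermite sums; the degree filtration (Folland 1989, §1.7)

Topic `Analysis/SegalBargmann`; namespace `Literature.Analysis.SegalBargmann`.  Continuation of
`Literature.Analysis.SegalBargmann.HermiteSumCalculus` (finite Hermite sums `IsHermiteSum S F`, their Parseval identity
and the exact `L²` sizes of `Z_j F`, `Z_j^* F`).  Here:

* §1 `x_j = ½(Z_j + Z_j^*)` and `D_j = (i/2)(Z_j^* − Z_j)` (`opDCLM_eq_ladder`) map a Hermite sum supported on `S` to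
  Hermite sums supported on `(S + 1_j) ∪ (S − 1_j)`, with `∫ ‖x_j F‖² ≤ (d+1)/π · ∫ ‖F‖²` and
  `∫ ‖D_j F‖² ≤ (d+1)/π · ∫ ‖F‖²` when `β_j ≤ d` on `S` (Folland (1.82) + Parseval + `∫‖u ± v‖² ≤ 2∫‖u‖² + 2∫‖v‖²`);
* §2 the DEGREE FILTRATION by the tree's `degLE d = {β : |β| ≤ d}` (`FockInfinitesimalAction`; `V_d = span {h_β : |β| ≤ d}`,
  `h_α ∈ V_{|α|}`): `x_j`, `D_j` map
  `V_d → V_{d+1}` with the bounds above, and the Fourier transform preserves every `V_d` together with the `L²` norm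
  on it (`𝓕 h_β = (−i)^{|β|} h_β`, `HermiteFourier`).

In words: each application of a coordinate or of a derivative to a Hermite expansion of degree `≤ d` costs one degree
and a factor `√((d+1)/π)` in `L²` — the operator form of the weighted-`L²` growth estimates for the Hermite functions,
the input of their polynomial sup-norm / Schwartz-seminorm bounds (the hard half of the `N`-representation theorem
for `𝒮(ℝⁿ)`).  Everything is proved from Mathlib and the imported tree files; no cited fact is used as a hypothesis.

## References

* G. B. Folland, *Harmonic Analysis in Phase Space*, Annals of Mathematics Studies 122, Princeton UP (1989), §1.7,
  (1.82) and (vii).  [cite: Folland1989, §1.7]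
* M. Reed, B. Simon, *Methods of Modern Mathematical Physics I*, Appendix to §V.3 (the `N`-representation of `𝒮`).

## Provenance

Written for the tree under the LEAN-IN-TREE rule (2026-08-18) by the pub-hodgecm formalisation cell (model-construction
sub-cell, seat mc-binder-2).
-/

set_option autoImplicit false

noncomputable section

open MvPolynomial Complex SchwartzMap MeasureTheory FourierTransform
open scoped BigOperators Real FourierTransform

namespace Literature.Analysis.SegalBargmann

variable {σ : Type*} [Fintype σ] [DecidableEq σ]

/-! ## §1  `x_j` and `D_j` on Hermite sums -/

section CoordinateDerivative

variable {S : Finset (σ →₀ ℕ)} {F : 𝓢(EuclideanSpace ℝ σ, ℂ)} (j : σ)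

/-- **`D_j = (i/2)(Z_j^* − Z_j)`** (`Z_j = X_j + iD_j`, `Z_j^* = X_j − iD_j`). [folklore] -/
theorem opDCLM_eq_ladder (f : 𝓢(EuclideanSpace ℝ σ, ℂ)) :
    opDCLM j f = (I / 2 : ℂ) • (zsCLM j f - zCLM j f) := by
  have hz : zCLM j f = coordMulCLM j f + I • opDCLM j f := rfl
  have hzs : zsCLM j f = coordMulCLM j f - I • opDCLM j f := rfl
  ext x
  simp only [hz, hzs, smul_apply, sub_apply, add_apply, smul_eq_mul]
  linear_combination (opDCLM j f x) * Complex.I_mul_I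

/-- `Z_j^* F` is a Hermite sum supported on `S + 1_j`. [folklore] -/
theorem IsHermiteSum.map_zsCLM (hF : IsHermiteSum S F) :
    IsHermiteSum (S.image fun β : σ →₀ ℕ => β + Finsupp.single j 1) (zsCLM j F) := by
  rw [← hF, zsCLM_sum_smul_herm]
  exact IsHermiteSum.sum _ _ fun β hβ => (isHermiteSum_herm (Finset.mem_image_of_mem _ hβ)).smul _

/-- `Z_j F` is a Hermite sum supported on `S − 1_j`. [folklore] -/
theorem IsHermiteSum.map_zCLM (hF : IsHermiteSum S F) :
    IsHermiteSum (S.image fun β : σ →₀ ℕ => β - Finsupp.single j 1) (zCLM j F) := by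
  rw [← hF, zCLM_sum_smul_herm]
  exact IsHermiteSum.sum _ _ fun β hβ => (isHermiteSum_herm (Finset.mem_image_of_mem _ hβ)).smul _

/-- `x_j F` is a Hermite sum supported on `(S + 1_j) ∪ (S − 1_j)`. [folklore] -/
theorem IsHermiteSum.map_coordMulCLM (hF : IsHermiteSum S F) :
    IsHermiteSum (S.image (fun β : σ →₀ ℕ => β + Finsupp.single j 1) ∪
      S.image (fun β : σ →₀ ℕ => β - Finsupp.single j 1)) (coordMulCLM j F) := by
  rw [coordMulCLM_eq_half_ladder, smul_add]
  exact (((hF.map_zCLM j).mono Finset.subset_union_right).smul _).add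
    (((hF.map_zsCLM j).mono Finset.subset_union_left).smul _)

/-- `D_j F` is a Hermite sum supported on `(S + 1_j) ∪ (S − 1_j)`. [folklore] -/
theorem IsHermiteSum.map_opDCLM (hF : IsHermiteSum S F) :
    IsHermiteSum (S.image (fun β : σ →₀ ℕ => β + Finsupp.single j 1) ∪
      S.image (fun β : σ →₀ ℕ => β - Finsupp.single j 1)) (opDCLM j F) := by
  rw [opDCLM_eq_ladder, smul_sub]
  exact (((hF.map_zsCLM j).mono Finset.subset_union_left).smul _).sub
    (((hF.map_zCLM j).mono Finset.subset_union_right).smul _)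

/-- **`∫ ‖Z_j^* F‖² ≤ (d+1)/π · ∫ ‖F‖²`** for a Hermite sum with `β_j ≤ d` on its support. [cite: Folland1989, §1.7] -/
theorem IsHermiteSum.integral_norm_sq_zsCLM_le (hF : IsHermiteSum S F) {d : ℕ} (hd : ∀ β ∈ S, β j ≤ d) :
    ∫ x : EuclideanSpace ℝ σ, ‖zsCLM j F x‖ ^ 2 ≤ (((d : ℝ) + 1) / π) * ∫ x : EuclideanSpace ℝ σ, ‖F x‖ ^ 2 := by
  have h := integral_norm_sq_zsCLM_sum_le j S (fun β => hermiteCoeff β F) d hd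
  rw [hF, ← hF.integral_norm_sq] at h
  exact h

/-- **`∫ ‖Z_j F‖² ≤ d/π · ∫ ‖F‖²`** for a Hermite sum with `β_j ≤ d` on its support. [cite: Folland1989, §1.7] -/
theorem IsHermiteSum.integral_norm_sq_zCLM_le (hF : IsHermiteSum S F) {d : ℕ} (hd : ∀ β ∈ S, β j ≤ d) :
    ∫ x : EuclideanSpace ℝ σ, ‖zCLM j F x‖ ^ 2 ≤ ((d : ℝ) / π) * ∫ x : EuclideanSpace ℝ σ, ‖F x‖ ^ 2 := by
  have h := integral_norm_sq_zCLM_sum_le j S (fun β => hermiteCoeff β F) d hd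
  rw [hF, ← hF.integral_norm_sq] at h
  exact h

/-- **`∫ ‖x_j F‖² ≤ (d+1)/π · ∫ ‖F‖²`** for a Hermite sum with `β_j ≤ d` on its support (`x_j = ½(Z_j + Z_j^*)`).
[cite: Folland1989, §1.7] -/
theorem IsHermiteSum.integral_norm_sq_coordMulCLM_le (hF : IsHermiteSum S F) {d : ℕ} (hd : ∀ β ∈ S, β j ≤ d) :
    ∫ x : EuclideanSpace ℝ σ, ‖coordMulCLM j F x‖ ^ 2 ≤
      (((d : ℝ) + 1) / π) * ∫ x : EuclideanSpace ℝ σ, ‖F x‖ ^ 2 := by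
  have hx : coordMulCLM j F = (1 / 2 : ℂ) • zCLM j F + (1 / 2 : ℂ) • zsCLM j F := by
    rw [coordMulCLM_eq_half_ladder, smul_add]
  have hhalf : ‖(1 / 2 : ℂ)‖ = 1 / 2 := by rw [norm_div, norm_one, Complex.norm_ofNat]
  have h1 := hF.integral_norm_sq_zCLM_le j hd
  have h2 := hF.integral_norm_sq_zsCLM_le j hd
  have h0 : 0 ≤ ∫ x : EuclideanSpace ℝ σ, ‖F x‖ ^ 2 := integral_nonneg fun x => by positivity
  have hdπ : (d : ℝ) / π ≤ ((d : ℝ) + 1) / π := div_le_div_of_nonneg_right (by linarith) Real.pi_pos.le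
  calc ∫ x : EuclideanSpace ℝ σ, ‖coordMulCLM j F x‖ ^ 2
      = ∫ x : EuclideanSpace ℝ σ, ‖((1 / 2 : ℂ) • zCLM j F + (1 / 2 : ℂ) • zsCLM j F) x‖ ^ 2 := by rw [hx]
    _ ≤ 2 * (∫ x : EuclideanSpace ℝ σ, ‖((1 / 2 : ℂ) • zCLM j F) x‖ ^ 2) +
          2 * ∫ x : EuclideanSpace ℝ σ, ‖((1 / 2 : ℂ) • zsCLM j F) x‖ ^ 2 := integral_norm_sq_add_le _ _
    _ = (1 / 2) * (∫ x : EuclideanSpace ℝ σ, ‖zCLM j F x‖ ^ 2) +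
          (1 / 2) * ∫ x : EuclideanSpace ℝ σ, ‖zsCLM j F x‖ ^ 2 := by
        rw [integral_norm_sq_smul, integral_norm_sq_smul, hhalf]
        ring
    _ ≤ (1 / 2) * (((d : ℝ) / π) * ∫ x : EuclideanSpace ℝ σ, ‖F x‖ ^ 2) +
          (1 / 2) * ((((d : ℝ) + 1) / π) * ∫ x : EuclideanSpace ℝ σ, ‖F x‖ ^ 2) := by
        gcongr
    _ ≤ (((d : ℝ) + 1) / π) * ∫ x : EuclideanSpace ℝ σ, ‖F x‖ ^ 2 := by
        nlinarith [mul_le_mul_of_nonneg_right hdπ h0]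

/-- **`∫ ‖D_j F‖² ≤ (d+1)/π · ∫ ‖F‖²`** for a Hermite sum with `β_j ≤ d` on its support (`D_j = (i/2)(Z_j^* − Z_j)`).
[cite: Folland1989, §1.7] -/
theorem IsHermiteSum.integral_norm_sq_opDCLM_le (hF : IsHermiteSum S F) {d : ℕ} (hd : ∀ β ∈ S, β j ≤ d) :
    ∫ x : EuclideanSpace ℝ σ, ‖opDCLM j F x‖ ^ 2 ≤
      (((d : ℝ) + 1) / π) * ∫ x : EuclideanSpace ℝ σ, ‖F x‖ ^ 2 := by
  have hD : opDCLM j F = (I / 2 : ℂ) • (zsCLM j F - zCLM j F) := opDCLM_eq_ladder j F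
  have hhalf : ‖(I / 2 : ℂ)‖ = 1 / 2 := by rw [norm_div, Complex.norm_I, Complex.norm_ofNat]
  have h1 := hF.integral_norm_sq_zCLM_le j hd
  have h2 := hF.integral_norm_sq_zsCLM_le j hd
  have h0 : 0 ≤ ∫ x : EuclideanSpace ℝ σ, ‖F x‖ ^ 2 := integral_nonneg fun x => by positivity
  have hdπ : (d : ℝ) / π ≤ ((d : ℝ) + 1) / π := div_le_div_of_nonneg_right (by linarith) Real.pi_pos.le
  calc ∫ x : EuclideanSpace ℝ σ, ‖opDCLM j F x‖ ^ 2
      = ∫ x : EuclideanSpace ℝ σ, ‖((I / 2 : ℂ) • (zsCLM j F - zCLM j F)) x‖ ^ 2 := by rw [hD]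
    _ = (1 / 4) * ∫ x : EuclideanSpace ℝ σ, ‖(zsCLM j F - zCLM j F) x‖ ^ 2 := by
        rw [integral_norm_sq_smul, hhalf]
        norm_num
    _ ≤ (1 / 4) * (2 * (∫ x : EuclideanSpace ℝ σ, ‖zsCLM j F x‖ ^ 2) +
          2 * ∫ x : EuclideanSpace ℝ σ, ‖zCLM j F x‖ ^ 2) := by
        gcongr
        exact integral_norm_sq_sub_le _ _
    _ ≤ (1 / 4) * (2 * ((((d : ℝ) + 1) / π) * ∫ x : EuclideanSpace ℝ σ, ‖F x‖ ^ 2) +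
          2 * (((d : ℝ) / π) * ∫ x : EuclideanSpace ℝ σ, ‖F x‖ ^ 2)) := by
        gcongr
    _ ≤ (((d : ℝ) + 1) / π) * ∫ x : EuclideanSpace ℝ σ, ‖F x‖ ^ 2 := by
        nlinarith [mul_le_mul_of_nonneg_right hdπ h0]

end CoordinateDerivative

/-! ## §2  The degree filtration `V_d = span {h_β : |β| ≤ d}` and the Fourier transform -/

section Degree

variable {S : Finset (σ →₀ ℕ)} {F : 𝓢(EuclideanSpace ℝ σ, ℂ)}

omit [DecidableEq σ] in
/-- Membership in the tree's `degLE d` (`FockInfinitesimalAction`, stated there with `mdeg`) in terms of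
`Finsupp.degree`. [folklore] -/
theorem mem_degLE_iff_degree_le {d : ℕ} {β : σ →₀ ℕ} : β ∈ (degLE d : Finset (σ →₀ ℕ)) ↔ β.degree ≤ d := by
  rw [mem_degLE, degree_eq_mdeg]

omit [DecidableEq σ] in
/-- `degLE` is monotone. [folklore] -/
theorem degLE_mono {d e : ℕ} (h : d ≤ e) : (degLE d : Finset (σ →₀ ℕ)) ⊆ degLE e :=
  fun _ hβ => mem_degLE.mpr ((mem_degLE.mp hβ).trans h)

/-- `degLE d + 1_j ⊆ degLE (d+1)`. [folklore] -/
theorem image_add_single_degLE_subset (d : ℕ) (j : σ) :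
    (degLE d : Finset (σ →₀ ℕ)).image (fun β : σ →₀ ℕ => β + Finsupp.single j 1) ⊆ degLE (d + 1) := by
  intro γ hγ
  obtain ⟨β, hβ, rfl⟩ := Finset.mem_image.mp hγ
  rw [mem_degLE_iff_degree_le] at hβ ⊢
  rw [map_add, Finsupp.degree_single]
  omega

/-- `degLE d − 1_j ⊆ degLE (d+1)` (indeed `⊆ degLE d`). [folklore] -/
theorem image_sub_single_degLE_subset (d : ℕ) (j : σ) :
    (degLE d : Finset (σ →₀ ℕ)).image (fun β : σ →₀ ℕ => β - Finsupp.single j 1) ⊆ degLE (d + 1) := by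
  intro γ hγ
  obtain ⟨β, hβ, rfl⟩ := Finset.mem_image.mp hγ
  rw [mem_degLE_iff_degree_le] at hβ ⊢
  exact (Finsupp.degree_mono tsub_le_self).trans (hβ.trans (Nat.le_succ d))

omit [DecidableEq σ] in
/-- On `degLE d` every component is `≤ d`. [folklore] -/
theorem apply_le_of_mem_degLE {d : ℕ} (j : σ) {β : σ →₀ ℕ} (hβ : β ∈ (degLE d : Finset (σ →₀ ℕ))) : β j ≤ d :=
  (Finsupp.le_degree j β).trans (mem_degLE_iff_degree_le.mp hβ)

/-- `h_α ∈ V_{|α|}`. [folklore] -/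
theorem isHermiteSum_herm_degLE (α : σ →₀ ℕ) : IsHermiteSum (degLE α.degree) (hermiteSchwartz (herm α)) :=
  isHermiteSum_herm (mem_degLE_iff_degree_le.mpr le_rfl)

/-- **`x_j : V_d → V_{d+1}`**. [cite: Folland1989, (1.82)] -/
theorem IsHermiteSum.map_coordMulCLM_degLE {d : ℕ} (j : σ) (hF : IsHermiteSum (degLE d) F) :
    IsHermiteSum (degLE (d + 1)) (coordMulCLM j F) :=
  (hF.map_coordMulCLM j).mono
    (Finset.union_subset (image_add_single_degLE_subset d j) (image_sub_single_degLE_subset d j))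

/-- **`D_j : V_d → V_{d+1}`**. [cite: Folland1989, (1.82)] -/
theorem IsHermiteSum.map_opDCLM_degLE {d : ℕ} (j : σ) (hF : IsHermiteSum (degLE d) F) :
    IsHermiteSum (degLE (d + 1)) (opDCLM j F) :=
  (hF.map_opDCLM j).mono
    (Finset.union_subset (image_add_single_degLE_subset d j) (image_sub_single_degLE_subset d j))

/-- **`∫ ‖x_j F‖² ≤ (d+1)/π · ∫ ‖F‖²` on `V_d`**. [cite: Folland1989, §1.7] -/
theorem IsHermiteSum.integral_norm_sq_coordMulCLM_le_degLE {d : ℕ} (j : σ) (hF : IsHermiteSum (degLE d) F) :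
    ∫ x : EuclideanSpace ℝ σ, ‖coordMulCLM j F x‖ ^ 2 ≤
      (((d : ℝ) + 1) / π) * ∫ x : EuclideanSpace ℝ σ, ‖F x‖ ^ 2 :=
  hF.integral_norm_sq_coordMulCLM_le j fun _ hβ => apply_le_of_mem_degLE j hβ

/-- **`∫ ‖D_j F‖² ≤ (d+1)/π · ∫ ‖F‖²` on `V_d`**. [cite: Folland1989, §1.7] -/
theorem IsHermiteSum.integral_norm_sq_opDCLM_le_degLE {d : ℕ} (j : σ) (hF : IsHermiteSum (degLE d) F) :
    ∫ x : EuclideanSpace ℝ σ, ‖opDCLM j F x‖ ^ 2 ≤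
      (((d : ℝ) + 1) / π) * ∫ x : EuclideanSpace ℝ σ, ‖F x‖ ^ 2 :=
  hF.integral_norm_sq_opDCLM_le j fun _ hβ => apply_le_of_mem_degLE j hβ

/-- **The Fourier transform preserves Hermite sums and their supports** (`𝓕 h_β = (−i)^{|β|} h_β`).
[cite: Folland1989, §1.7] -/
theorem IsHermiteSum.map_fourier (hF : IsHermiteSum S F) : IsHermiteSum S (𝓕 F) := by
  have h : 𝓕 F = ∑ β ∈ S, (hermiteCoeff β F * (-I) ^ β.degree) • hermiteSchwartz (herm β) := by
    conv_lhs => rw [← hF]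
    rw [FourierTransform.fourier_sum]
    refine Finset.sum_congr rfl fun β _ => ?_
    rw [FourierSMul.fourier_smul, fourier_hermiteSchwartz_herm, smul_smul]
  rw [h]
  exact isHermiteSum_sum_smul S _

/-- The Hermite coefficients of `𝓕 F` have the same size as those of `F`. [cite: Folland1989, §1.7] -/
theorem norm_hermiteCoeff_fourier (β : σ →₀ ℕ) (F : 𝓢(EuclideanSpace ℝ σ, ℂ)) :
    ‖hermiteCoeff β (𝓕 F)‖ = ‖hermiteCoeff β F‖ := by
  rw [hermiteCoeff_fourier, norm_mul, norm_pow, norm_neg, Complex.norm_I, one_pow, one_mul]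

/-- **Plancherel on Hermite sums**: `∫ ‖𝓕 F‖² = ∫ ‖F‖²`. [cite: Folland1989, §1.7] -/
theorem IsHermiteSum.integral_norm_sq_fourier (hF : IsHermiteSum S F) :
    ∫ x : EuclideanSpace ℝ σ, ‖𝓕 F x‖ ^ 2 = ∫ x : EuclideanSpace ℝ σ, ‖F x‖ ^ 2 := by
  rw [hF.map_fourier.integral_norm_sq, hF.integral_norm_sq]
  simp_rw [norm_hermiteCoeff_fourier]

end Degree

end Literature.Analysis.SegalBargmann

end
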